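import Mathlib
import Summits.NavierStokesRegularity.NavierStokesRegularity.Theorems.TaoLadderRungTwoFlatHopTube
import HarnessLib

/-!
# HOP TUBE WITH a parametric behind clause (part 1 of 2) — theory-1 g45's re-typed frame for referee W-26 / A-102: the frame and its composition to gap data
  (helper for the K_A♭ parent item stmt-NavierStokesRegularity-22987 `FlatGapCertificatesV2`, child 2A `GradedAdiabaticWakeA`
  of route TaoLadderRungTwoFlat; cell harvest/h2-tao-ladder, theory-1 g45, memo numT57/NEAR-BEHIND-57 §5 / LADDER §57.8)

PROVENANCE (p1 g23): theory-1 g45's image of record numT57/TubeFrameWith57.lean sha16 3eac36db9e3dc44f (386 l., farm `lean check`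
rc 0 · 0 sorry · 0 warnings · std axioms), landed with declarations BYTE-IDENTICAL in TWO modules (400-line lint): part 1
`…HopTubeWith` (frame + composition: `InTubeWith`, `tubeSetWith`, `HopPremiseWith`, `TubeStep…With`, `TubeStaticsWith`,
`TubeExistWith`, `stepToWith_of_obligations`, `gapData₂On_of_tubeWith`, `gradedWake_clause_of_tubeWith`), part 2 `…HopTubeWithGlue`
(choice-rule adapters `tubeStep…With_of_good` + the R54 instance `behindR54`, `behindCapR54_of_good`, `tubeStepBehindR54_of_good`,
`behindR54_of_hopPremiseWith`). The image's module docstring follows verbatim.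

# Cell Lean (theory-1 g45, numT57): the `H(n)` tube frame PARAMETRIC in the behind clause, and its R54 instance
  (referee c88/c89 W-26, A-102; helper shapes for the K_A♭ parent item stmt-NavierStokesRegularity-22987
  `FlatGapCertificatesV2`, child 2A `GradedAdiabaticWakeA` of route TaoLadderRungTwoFlat; cell harvest/h2-tao-ladder)

The tree frame `…Theorems.TaoLadderRungTwoFlatHopTube` fixes the behind conjunct of `InTube` to the sup envelope
`BehindClause P ε₀ n z`, which the cell RETIRED as hop invariant (LADDER §54.2, TRAP #11); the R54 behind modules
(`R54.behindEnergyClause_hop_of_schedule_sharp`, `R54.exists_behindCap_recentre`, …) conclude the (B1)/(B2) clauses of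
`…ZoneGeometry` instead, and nothing composes them to the gap data yet (referee W-26). This file re-types the frame ONCE
with the behind conjunct a PARAMETER `Bcl : ℕ → (Fin 2 → ℤ → ℝ) → Prop` — `InTubeWith`, `tubeSetWith`, `HopPremiseWith`,
the per-hop obligations `TubeStep…With`, `tubeStepLandWith_of_zones`, `TubeStaticsWith`, `TubeExistWith`, and the
composition `stepToWith_of_obligations` / `gapData₂On_of_tubeWith` / `gradedWake_clause_of_tubeWith` (texts and proofs
of the tree frame verbatim with `BehindClause P ε₀` ↦ `Bcl`; `inTubeWith_behindClause`: the tree frame is the instance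
`Bcl := BehindClause P ε₀`) — plus the choice-rule adapters of `…HopRuleGlue` against the parametric frame
(`tubeStep{Core,Near,Behind,Ahead,Anchor,Clock,Land}With_of_good`, A-102) and the R54 INSTANCE
`behindR54 P θ′ Wb n z := R54.BehindEnergyClause P.K θ′ (Wb n) z ∧ ∃ Λ, 0 ≤ Λ ∧ R54.BehindCapClause P.K Λ z`
((B1) with schedule `Wb`, (B2) EXISTENTIAL per state — p1 g23's recommendation, adopted in LADDER §57.5), whose (B2∃)
half is discharged at frame level for graded mirror flows by `behindCapR54_of_good` (from `R54.exists_behindCap_recentre`),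
so that `tubeStepBehindR54_of_good` takes ONLY the (B1) landing `R54.BehindEnergyClause P.K θ′ (Wb (n+1)) (recentre S t a)`
at good times — the conclusion shape of `R54.behindEnergyClause_hop_of_schedule_sharp` / `_fed`.

HONEST FRAMING: pure logic/bookkeeping (definitions + compositions); MODEL lattices only; the obligations remain
HYPOTHESES of the final theorems; nothing certified; no item closed; nothing here is about the Navier–Stokes equations.
Cell file (theory desk); p1 may land it or re-cut it.
-/

noncomputable section

-- the sub-problem namespace repeats the summit name by design (D-0017)
set_option linter.dupNamespace false

namespace Summit.NavierStokesRegularity.NavierStokesRegularity.Theorems.HopTube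

open Set Finset Literature.Analysis.FluidPDE Literature.Analysis.FluidPDE.TaoCascade MirrorPulse

/-! ## The tube with a parametric behind clause -/

/-- **`H(n)` with the behind conjunct a parameter `Bcl n z`.** [cite: Tao2016AveragedNS, §6.3–6.4 (statement shape); cell LADDER §50, §54.2 (R54-1), §57.5] -/
def InTubeWith (P : TubeSchedule) (Bcl : ℕ → (Fin 2 → ℤ → ℝ) → Prop) (i₀ : Fin 2) (X₀ : Fin 2 → ℝ) (w : ℤ → ℝ)
    (r : ℝ) (ζ : ℕ → Fin 2 → ℤ → ℝ) (ustar : Fin 2 → ℤ → ℝ) (n : ℕ) (z : Fin 2 → ℤ → ℝ) : Prop :=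
  if n = 0 then z = datumState i₀ X₀
  else if n ≤ P.N₀ then CaptureClause P ζ n z ∧ AheadClause P w r z
  else AnchorClause P i₀ n z ∧ CoreClause P i₀ ustar n z ∧ NearClause P i₀ ustar n z ∧ Bcl n z ∧
    AheadClause P w r z

/-- The tree frame is the instance `Bcl := BehindClause P ε₀`. [folklore (definitional); cell LADDER §57.5] -/
theorem inTubeWith_behindClause (P : TubeSchedule) (ε₀ : ℝ) (i₀ : Fin 2) (X₀ : Fin 2 → ℝ) (w : ℤ → ℝ) (r : ℝ)
    (ζ : ℕ → Fin 2 → ℤ → ℝ) (ustar : Fin 2 → ℤ → ℝ) :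
    InTubeWith P (BehindClause P ε₀) i₀ X₀ w r ζ ustar = InTube P ε₀ i₀ X₀ w r ζ ustar := rfl

/-- The described reference set `Z = ⋃ₙ {z | H(n) z}` for the parametric tube. [cite: Tao2016AveragedNS, §6.3–6.4 (statement shape); cell LADDER §50, §57.5] -/
def tubeSetWith (P : TubeSchedule) (Bcl : ℕ → (Fin 2 → ℤ → ℝ) → Prop) (i₀ : Fin 2) (X₀ : Fin 2 → ℝ) (w : ℤ → ℝ)
    (r : ℝ) (ζ : ℕ → Fin 2 → ℤ → ℝ) (ustar : Fin 2 → ℤ → ℝ) : Set (Fin 2 → ℤ → ℝ) :=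
  {z | ∃ n, InTubeWith P Bcl i₀ X₀ w r ζ ustar n z}

/-- The normalised datum is a hop-`0` state of the parametric tube. [cite: Tao2016AveragedNS, §6.4 Prop. 6.5 (statement shape); cell LADDER §50] -/
theorem datum_mem_tubeSetWith (P : TubeSchedule) (Bcl : ℕ → (Fin 2 → ℤ → ℝ) → Prop) (i₀ : Fin 2) (X₀ : Fin 2 → ℝ)
    (w : ℤ → ℝ) (r : ℝ) (ζ : ℕ → Fin 2 → ℤ → ℝ) (ustar : Fin 2 → ℤ → ℝ) :
    datumState i₀ X₀ ∈ tubeSetWith P Bcl i₀ X₀ w r ζ ustar :=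
  ⟨0, by simp [InTubeWith]⟩

/-! ## The per-hop obligations, parametric -/

section ObligationsWith

variable (P : TubeSchedule) (Bcl : ℕ → (Fin 2 → ℤ → ℝ) → Prop) (rule : HopRule) (𝕊 : Finset (ℤ × ℤ × ℤ)) (σ ε₀ : ℝ)
  (i₀ : Fin 2) (α : Fin 2 → Fin 2 → Fin 2 → ℤ × ℤ × ℤ → ℝ) (X₀ : Fin 2 → ℝ) (w : ℤ → ℝ) (r θ₀ c₀ : ℝ) (env₀ : ℤ → ℝ)
  (ζ : ℕ → Fin 2 → ℤ → ℝ) (ustar : Fin 2 → ℤ → ℝ)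

/-- The common premise of every hop obligation at hop `n`, parametric tube. [cite: Tao2016AveragedNS, §6.4 Prop. 6.5 (statement shape); cell certificate format v2] -/
def HopPremiseWith (n : ℕ) (z S₀ : Fin 2 → ℤ → ℝ) (τ : ℝ) (S F : Fin 2 → ℤ → ℝ → ℝ) : Prop :=
  InTubeWith P Bcl i₀ X₀ w r ζ ustar n z ∧ (∀ i k, w k * |S₀ i k - z i k| ≤ r) ∧ c₀ ≤ τ ∧
    PseudoFlowOnShift 𝕊 τ ε₀ α 0 0 S₀ (fun i k => (1 / 2) * S₀ i k ^ 2) (fun _ _ => 0) S F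

/-- CLOCK/RATIO/SLACK obligation, parametric tube. [cite: Tao2016AveragedNS, §6.4 Prop. 6.5; cell TRANSFER-CONSTANTS §4] -/
def TubeStepClockWith (n : ℕ) : Prop :=
  ∀ z S₀ τ S F, HopPremiseWith P Bcl 𝕊 ε₀ i₀ α X₀ w r c₀ ζ ustar n z S₀ τ S F →
    0 < rule.τ₁ n S ∧ rule.τ₁ n S ≤ c₀ ∧ 0 < rule.a n S ∧ (1 + ε₀) ^ (-θ₀) ≤ rule.a n S ∧
      rule.a n S ≤ |S i₀ 1 (rule.τ₁ n S)| ∧ (1 + σ) * rule.a n S ≤ |S i₀ 1 (rule.τ₁ n S)|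

/-- ENVELOPE obligation, parametric tube. [cite: Tao2016AveragedNS, §6.4 Prop. 6.5 (iv); cell TRANSFER-CONSTANTS §2] -/
def TubeStepEnvelopeWith (n : ℕ) : Prop :=
  ∀ z S₀ τ S F, HopPremiseWith P Bcl 𝕊 ε₀ i₀ α X₀ w r c₀ ζ ustar n z S₀ τ S F →
    ∀ s ∈ Icc 0 (rule.τ₁ n S), epochEnvelope env₀ (fun i k => S i k s) (fun i k => F i k s)

/-- CAPTURE obligation (`n + 1 ≤ N₀`), parametric tube. [cite: Tao2016AveragedNS, §6.2 Prop. 6.3 (ix), §6.3–6.4; cell LADDER §47.5 L1/L3] -/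
def TubeStepCaptureWith (n : ℕ) : Prop :=
  ∀ z S₀ τ S F, HopPremiseWith P Bcl 𝕊 ε₀ i₀ α X₀ w r c₀ ζ ustar n z S₀ τ S F →
    CaptureClause P ζ (n + 1) (recentre S (rule.τ₁ n S) (rule.a n S)) ∧
      AheadClause P w r (recentre S (rule.τ₁ n S) (rule.a n S))

/-- TUBE LANDING obligation (`n ≥ N₀`), parametric tube: anchor, core, near, `Bcl (n+1)` and ahead for the
re-centred state. [cite: Tao2016AveragedNS, §6.3–6.4; cell LADDER §50.3, §57.5] -/
def TubeStepLandWith (n : ℕ) : Prop :=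
  ∀ z S₀ τ S F, HopPremiseWith P Bcl 𝕊 ε₀ i₀ α X₀ w r c₀ ζ ustar n z S₀ τ S F →
    AnchorClause P i₀ (n + 1) (recentre S (rule.τ₁ n S) (rule.a n S)) ∧
    CoreClause P i₀ ustar (n + 1) (recentre S (rule.τ₁ n S) (rule.a n S)) ∧
    NearClause P i₀ ustar (n + 1) (recentre S (rule.τ₁ n S) (rule.a n S)) ∧
    Bcl (n + 1) (recentre S (rule.τ₁ n S) (rule.a n S)) ∧
    AheadClause P w r (recentre S (rule.τ₁ n S) (rule.a n S))

/-- Zone obligation ANCHOR, parametric tube. [cite: Tao2016AveragedNS, §6.4; cell TRANSFER-CONSTANTS §4] -/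
def TubeStepAnchorWith (n : ℕ) : Prop :=
  ∀ z S₀ τ S F, HopPremiseWith P Bcl 𝕊 ε₀ i₀ α X₀ w r c₀ ζ ustar n z S₀ τ S F →
    AnchorClause P i₀ (n + 1) (recentre S (rule.τ₁ n S) (rule.a n S))

/-- Zone obligation CORE, parametric tube. [cite: Tao2016AveragedNS, §6.3–6.4; cell LADDER §47.5 L3/L4, §56] -/
def TubeStepCoreWith (n : ℕ) : Prop :=
  ∀ z S₀ τ S F, HopPremiseWith P Bcl 𝕊 ε₀ i₀ α X₀ w r c₀ ζ ustar n z S₀ τ S F →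
    CoreClause P i₀ ustar (n + 1) (recentre S (rule.τ₁ n S) (rule.a n S))

/-- Zone obligation NEAR, parametric tube. [cite: Tao2016AveragedNS, §6.3–6.4; cell LADDER §49, §57] -/
def TubeStepNearWith (n : ℕ) : Prop :=
  ∀ z S₀ τ S F, HopPremiseWith P Bcl 𝕊 ε₀ i₀ α X₀ w r c₀ ζ ustar n z S₀ τ S F →
    NearClause P i₀ ustar (n + 1) (recentre S (rule.τ₁ n S) (rule.a n S))

/-- Zone obligation BEHIND, parametric tube: `Bcl (n+1)` of the re-centred state. [cite: Tao2016AveragedNS, §6.3–6.4; cell LADDER §54 (R54-1), §57.5] -/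
def TubeStepBehindWith (n : ℕ) : Prop :=
  ∀ z S₀ τ S F, HopPremiseWith P Bcl 𝕊 ε₀ i₀ α X₀ w r c₀ ζ ustar n z S₀ τ S F →
    Bcl (n + 1) (recentre S (rule.τ₁ n S) (rule.a n S))

/-- Zone obligation AHEAD, parametric tube. [cite: Tao2016AveragedNS, §6.2 Prop. 6.3 (ix); cell LADDER §47.5 L1] -/
def TubeStepAheadWith (n : ℕ) : Prop :=
  ∀ z S₀ τ S F, HopPremiseWith P Bcl 𝕊 ε₀ i₀ α X₀ w r c₀ ζ ustar n z S₀ τ S F →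
    AheadClause P w r (recentre S (rule.τ₁ n S) (rule.a n S))

/-- The five zone obligations compose to the landing obligation (parametric tube). [cite: Tao2016AveragedNS, §6.3–6.4; cell LADDER §50.3, §57.5] -/
theorem tubeStepLandWith_of_zones {n : ℕ}
    (hA : TubeStepAnchorWith P Bcl rule 𝕊 ε₀ i₀ α X₀ w r c₀ ζ ustar n)
    (hC : TubeStepCoreWith P Bcl rule 𝕊 ε₀ i₀ α X₀ w r c₀ ζ ustar n)
    (hN : TubeStepNearWith P Bcl rule 𝕊 ε₀ i₀ α X₀ w r c₀ ζ ustar n)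
    (hB : TubeStepBehindWith P Bcl rule 𝕊 ε₀ i₀ α X₀ w r c₀ ζ ustar n)
    (hH : TubeStepAheadWith P Bcl rule 𝕊 ε₀ i₀ α X₀ w r c₀ ζ ustar n) :
    TubeStepLandWith P Bcl rule 𝕊 ε₀ i₀ α X₀ w r c₀ ζ ustar n :=
  fun z S₀ τ S F h => ⟨hA z S₀ τ S F h, hC z S₀ τ S F h, hN z S₀ τ S F h, hB z S₀ τ S F h, hH z S₀ τ S F h⟩

/-- STATICS of the described set (parametric tube). [cite: Tao2016AveragedNS, §6.2–6.4 (statement shape); cell TRANSFER-CONSTANTS §2] -/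
def TubeStaticsWith (θ c : ℝ) : Prop :=
  0 < r ∧ 0 ≤ θ₀ ∧ θ₀ < θ ∧ θ ≤ 1 / 2 ∧ 0 < c₀ ∧ c₀ < c ∧ 0 < σ ∧ (∀ k, 1 ≤ w k) ∧
    TailFat ε₀ (tubeSetWith P Bcl i₀ X₀ w r ζ ustar) w r ∧ TameBehind ε₀ (tubeSetWith P Bcl i₀ X₀ w r ζ ustar) w ∧
    TailCompat ε₀ (tubeSetWith P Bcl i₀ X₀ w r ζ ustar) w r env₀

/-- EXISTENCE of exact format flows on `[0, c]` from the weighted `r`-ball around the parametric tube (L2).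
[cite: Tao2016AveragedNS, §4 Lemma 4.1 (local theory); cell LADDER §47.5 L2] -/
def TubeExistWith (c : ℝ) : Prop :=
  ∀ S₀ : Fin 2 → ℤ → ℝ,
    ballDesc (tubeSetWith P Bcl i₀ X₀ w r ζ ustar) w r S₀ (fun i k => (1 / 2) * S₀ i k ^ 2) →
      ∃ S F : Fin 2 → ℤ → ℝ → ℝ,
        PseudoFlowOnShift 𝕊 c ε₀ α 0 0 S₀ (fun i k => (1 / 2) * S₀ i k ^ 2) (fun _ _ => 0) S F

end ObligationsWith

/-! ## The composition, parametric: `H(n)`-induction ⇒ format-v2 gap data with `Z := tubeSetWith`, `ρ := 0` -/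

/-- One hop of the induction for the parametric tube. [cite: Tao2016AveragedNS, §6.4 Prop. 6.5 (statement shape); cell LADDER §50, §57.5] -/
theorem stepToWith_of_obligations (P : TubeSchedule) (Bcl : ℕ → (Fin 2 → ℤ → ℝ) → Prop) (rule : HopRule)
    {𝕊 : Finset (ℤ × ℤ × ℤ)} {σ ε₀ : ℝ} {i₀ : Fin 2} {α : Fin 2 → Fin 2 → Fin 2 → ℤ × ℤ × ℤ → ℝ} {X₀ : Fin 2 → ℝ}
    {w : ℤ → ℝ} {r θ₀ c₀ : ℝ} {env₀ : ℤ → ℝ} {ζ : ℕ → Fin 2 → ℤ → ℝ} {ustar : Fin 2 → ℤ → ℝ} {n : ℕ}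
    (hclock : TubeStepClockWith P Bcl rule 𝕊 σ ε₀ i₀ α X₀ w r θ₀ c₀ ζ ustar n)
    (henv : TubeStepEnvelopeWith P Bcl rule 𝕊 ε₀ i₀ α X₀ w r c₀ env₀ ζ ustar n)
    (hcap : n + 1 ≤ P.N₀ → TubeStepCaptureWith P Bcl rule 𝕊 ε₀ i₀ α X₀ w r c₀ ζ ustar n)
    (hland : P.N₀ ≤ n → TubeStepLandWith P Bcl rule 𝕊 ε₀ i₀ α X₀ w r c₀ ζ ustar n)
    {z S₀ : Fin 2 → ℤ → ℝ} {τ : ℝ} {S F : Fin 2 → ℤ → ℝ → ℝ}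
    (h : HopPremiseWith P Bcl 𝕊 ε₀ i₀ α X₀ w r c₀ ζ ustar n z S₀ τ S F) :
    StepTo ε₀ θ₀ c₀ i₀ (ballDesc (tubeSetWith P Bcl i₀ X₀ w r ζ ustar) w (0 * r)) (epochEnvelope env₀) S F
        (rule.τ₁ n S) (rule.a n S) ∧ (1 + σ) * rule.a n S ≤ |S i₀ 1 (rule.τ₁ n S)| := by
  obtain ⟨h1, h2, h3, h4, h5, h6⟩ := hclock z S₀ τ S F h
  have hmem : recentre S (rule.τ₁ n S) (rule.a n S) ∈ tubeSetWith P Bcl i₀ X₀ w r ζ ustar := by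
    refine ⟨n + 1, ?_⟩
    by_cases hn : n + 1 ≤ P.N₀
    · have hc := hcap hn z S₀ τ S F h
      simp only [InTubeWith, Nat.succ_ne_zero, if_false, if_pos hn]
      exact hc
    · have hl := hland (by omega) z S₀ τ S F h
      simp only [InTubeWith, Nat.succ_ne_zero, if_false, if_neg hn]
      exact hl
  refine ⟨⟨h1, h2, h3, h4, h5, ?_, henv z S₀ τ S F h⟩, h6⟩
  exact ballDesc_of_mem hmem (by simp) _

/-- **`H(n)`-INDUCTION ⇒ GAP DATA, parametric tube.** Statics + existence + the per-hop obligations for every `n` give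
format-v2 gap data with `Z := tubeSetWith …` and `ρ := 0`. [cite: Tao2016AveragedNS, §6.3–6.4 Props. 6.4–6.5 (statement shape); cell LADDER §50, §57.5] -/
theorem gapData₂On_of_tubeWith (P : TubeSchedule) (Bcl : ℕ → (Fin 2 → ℤ → ℝ) → Prop) (rule : HopRule)
    {𝕊 : Finset (ℤ × ℤ × ℤ)} {σ ε₀ : ℝ} {i₀ : Fin 2} {α : Fin 2 → Fin 2 → Fin 2 → ℤ × ℤ × ℤ → ℝ} {X₀ : Fin 2 → ℝ}
    {w : ℤ → ℝ} {r θ₀ θ c₀ c : ℝ} {env₀ : ℤ → ℝ} {ζ : ℕ → Fin 2 → ℤ → ℝ} {ustar : Fin 2 → ℤ → ℝ}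
    (hstat : TubeStaticsWith P Bcl σ ε₀ i₀ X₀ w r θ₀ c₀ env₀ ζ ustar θ c)
    (hexist : TubeExistWith P Bcl 𝕊 ε₀ i₀ α X₀ w r ζ ustar c)
    (hclock : ∀ n, TubeStepClockWith P Bcl rule 𝕊 σ ε₀ i₀ α X₀ w r θ₀ c₀ ζ ustar n)
    (henv : ∀ n, TubeStepEnvelopeWith P Bcl rule 𝕊 ε₀ i₀ α X₀ w r c₀ env₀ ζ ustar n)
    (hcap : ∀ n, n + 1 ≤ P.N₀ → TubeStepCaptureWith P Bcl rule 𝕊 ε₀ i₀ α X₀ w r c₀ ζ ustar n)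
    (hland : ∀ n, P.N₀ ≤ n → TubeStepLandWith P Bcl rule 𝕊 ε₀ i₀ α X₀ w r c₀ ζ ustar n) :
    GapData₂On 𝕊 σ ε₀ i₀ α X₀ (tubeSetWith P Bcl i₀ X₀ w r ζ ustar) w r 0 θ₀ θ c₀ c env₀ := by
  obtain ⟨hr, hθ0, hθ, hθh, hc0, hc, hσ, hw, hfat, htame, hcompat⟩ := hstat
  have hstep' : ∀ (S₀ : Fin 2 → ℤ → ℝ) (τ : ℝ) (S F : Fin 2 → ℤ → ℝ → ℝ),
      ballDesc (tubeSetWith P Bcl i₀ X₀ w r ζ ustar) w r S₀ (fun i k => (1 / 2) * S₀ i k ^ 2) → c₀ ≤ τ →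
        PseudoFlowOnShift 𝕊 τ ε₀ α 0 0 S₀ (fun i k => (1 / 2) * S₀ i k ^ 2) (fun _ _ => 0) S F →
          ∃ τ₁ a : ℝ, StepTo ε₀ θ₀ c₀ i₀ (ballDesc (tubeSetWith P Bcl i₀ X₀ w r ζ ustar) w (0 * r))
            (epochEnvelope env₀) S F τ₁ a ∧ (1 + σ) * a ≤ |S i₀ 1 τ₁| := by
    intro S₀ τ S F hball hτ hflow
    obtain ⟨z, ⟨n, hz⟩, hkick⟩ := hball
    exact ⟨rule.τ₁ n S, rule.a n S,
      stepToWith_of_obligations P Bcl rule (hclock n) (henv n) (hcap n) (hland n) ⟨hz, hkick, hτ, hflow⟩⟩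
  refine ⟨⟨hr, le_rfl, zero_lt_one, hθ0, hθ, hθh, hc0, hc, hw, datum_mem_tubeSetWith P Bcl i₀ X₀ w r ζ ustar, hfat,
    hexist, ?_⟩, hσ, htame, hstep', hcompat⟩
  intro S₀ τ S F hball hτ hflow
  obtain ⟨τ₁, a, hst, -⟩ := hstep' S₀ τ S F hball hτ hflow
  exact ⟨τ₁, a, hst⟩

/-- The child-2 shape for the parametric tube: `H(n)`-induction data at one `ε₀` for the graded MIRROR table give the
`∃`-clause of `GradedAdiabaticWake`'s conclusion at that `ε₀` (`ρ' = 0`), given `TailThin`.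
[cite: Tao2016AveragedNS, §6.3–6.4 (statement shape); cell LADDER §50, §57.5; route TaoLadderRungTwoFlat item GradedAdiabaticWake] -/
theorem gradedWake_clause_of_tubeWith (P : TubeSchedule) (Bcl : ℕ → (Fin 2 → ℤ → ℝ) → Prop) (rule : HopRule)
    {σ ε ε₀ : ℝ} {i₀ : Fin 2} {X₀ : Fin 2 → ℝ} {w : ℤ → ℝ} {r θ₀ θ c₀ c : ℝ} {env₀ : ℤ → ℝ}
    {ζ : ℕ → Fin 2 → ℤ → ℝ} {ustar : Fin 2 → ℤ → ℝ}
    (hstat : TubeStaticsWith P Bcl σ ε₀ i₀ X₀ w r θ₀ c₀ env₀ ζ ustar θ c)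
    (hexist : TubeExistWith P Bcl shiftSetFlat ε₀ i₀ (mirrorTable ε ε) X₀ w r ζ ustar c)
    (hclock : ∀ n, TubeStepClockWith P Bcl rule shiftSetFlat σ ε₀ i₀ (mirrorTable ε ε) X₀ w r θ₀ c₀ ζ ustar n)
    (henv : ∀ n, TubeStepEnvelopeWith P Bcl rule shiftSetFlat ε₀ i₀ (mirrorTable ε ε) X₀ w r c₀ env₀ ζ ustar n)
    (hcap : ∀ n, n + 1 ≤ P.N₀ →
      TubeStepCaptureWith P Bcl rule shiftSetFlat ε₀ i₀ (mirrorTable ε ε) X₀ w r c₀ ζ ustar n)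
    (hland : ∀ n, P.N₀ ≤ n → TubeStepLandWith P Bcl rule shiftSetFlat ε₀ i₀ (mirrorTable ε ε) X₀ w r c₀ ζ ustar n)
    (hthin : TailThin ε₀ w r) :
    ∃ (σ' : ℝ) (Z : Set (Fin 2 → ℤ → ℝ)) (w' : ℤ → ℝ) (r' ρ' θ₀' θ' c₀' c' : ℝ) (env₀' : ℤ → ℝ),
      GapData₂On shiftSetFlat σ' ε₀ i₀ (mirrorTable ε ε) X₀ Z w' r' ρ' θ₀' θ' c₀' c' env₀' ∧ TailThin ε₀ w' r' :=
  ⟨σ, tubeSetWith P Bcl i₀ X₀ w r ζ ustar, w, r, 0, θ₀, θ, c₀, c, env₀,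
    gapData₂On_of_tubeWith P Bcl rule hstat hexist hclock henv hcap hland, hthin⟩

end Summit.NavierStokesRegularity.NavierStokesRegularity.Theorems.HopTube

end
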